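import Summits.FinalStateConjecture.FinalStateConjecture.Theorems.ZeroEnergyKerrOrBombSymplecticDualOfTheBombDefs
import Literature.Geometry.Lorentzian.MetricAdjointTrace
import HarnessLib

/-!
# Route ZeroEnergyKerrOrBomb · crux `StationaryLimitReduction` (stmt-FinalStateConjecture-10021), line
# `symplectic-dual-of-the-bomb` — stub `stub_dualModeEjection`: TYPING VERDICTS with kernel witnesses

Helper file (`--supports stmt-FinalStateConjecture-10021`) of the lead's wave-1 stub worker for
`stub_dualModeEjection : Sig.stub_dualModeEjection` (lead prover-line-stmt-FinalStateConjecture-10021-a1-0,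
2026-08-16). The registered statement (the card's construction (C) — the backward dual mode of the
bomb carried to Cauchy data = DETECTORS on `Σ₀` by conservation of the ADM symplectic current — plus
its residuals (S) saddle and (F) fate) is OPEN as mathematics and nothing dynamical about an MGHD is
constructible in this tree. What IS decidable here is its typing, and the verdict is negative:

* §A `settlesWith_mono`, `settlesWith_true_of_settlesWith_modeStable` (the composition's case split);
  `not_injOn_ball_of_forall_mem_range_fin0`: `k = 0` detectors can never satisfy the conclusion.
* §B `HasNoLocalKillingFieldNear 𝒟 x₀` (first conjunct of `AreDetectorsAt`) is a GLOBAL notion: it is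
  implied at every `x₀` by "no global Killing initial data" (`hasNoLocalKillingFieldNear_of_global`,
  witness `V = univ`) and refuted at every `x₀` by one densely non-vanishing Killing field of the
  development (`not_hasNoLocalKillingFieldNear_of_killing`).
* §C THE COLLAPSE: `AreDetectorsAt` does not require SYMMETRIC detectors; an antisymmetric detector
  `(A₀, 0)` exists at every such point (`exists_antisymm_areDetectorsAt`: smooth near `x₀` by
  construction in the tangent trivialisation, non-gauge because slice tangents are symmetric), and its
  pairing matrix against EVERY family is singular (`det_pairingMatrix_eq_zero_of_antisymm`:
  `S_{ij}T^{ij} = 0 = h^{ij}T_{ij}` for `S` symmetric, `T` antisymmetric, via the tree's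
  `MetricAdjointTrace`). Hence the registered text is EQUIVALENT to the bare claim "under the
  hypotheses some `x₀` satisfies `HasNoLocalKillingFieldNear`" (`stub_dualModeEjection_of_kidFree`,
  `kidFree_of_stub_dualModeEjection`): its dynamical content is vacuous as typed, and what remains is
  false in the symmetric-bomb scenario (`stub_dualModeEjection_false_of_symmetricBomb`).
* §E the same defect makes the neighbour `Sig.stub_moncriefTransversality` false modulo ONE
  Killing-free point of ONE vacuum development of ONE admissible datum
  (`moncriefTransversality_false_of_kidFreePoint`; the neighbour's text is quoted, not asserted).

Repair proposed to the lead (report `work/stubs/StubDualModeEjection.md`): symmetric detectors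
(`∀ j x v w, A j x v w = A j x w v ∧ B j x v w = B j x w v`) in both stub texts, and Killing-freeness
(`∀ x, HasNoLocalKillingFieldNear 𝒟 x`, i.e. no global KID) moved to the HYPOTHESIS side of
`stub_dualModeEjection`, supplied in the composition by a dichotomy whose symmetric branch is a cure
stub. No named fact, no new definition; Mathlib + the landed Defs module + `MetricAdjointTrace` only.
-/

-- every `Summit.FinalStateConjecture.FinalStateConjecture.…` name repeats the summit = sub-problem segment (D-0017 layout)
set_option linter.dupNamespace false
set_option maxSynthPendingDepth 3

noncomputable section

open scoped Manifold ContDiff Topology BigOperators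
open Set Filter Bundle MeasureTheory Literature.Geometry.Lorentzian

namespace Summit.FinalStateConjecture.FinalStateConjecture.Theorems.SymplecticDualOfTheBomb

open Summit.FinalStateConjecture.FinalStateConjecture.Theorems.OneLockedExplosion

/-! ## §A Cheap registered helpers: monotonicity of `SettlesWith`, the `k = 0` junk check -/

/-- **Monotonicity of `SettlesWith` in the hole property.** [folklore] -/
theorem settlesWith_mono : ∀ (Q Q' : StationaryAFBlackHole.{0} → Prop) (X : Type) [TopologicalSpace X] [ChartedSpace E3 X] [IsManifold (𝓡 3) ∞ X] [T2Space X] [SecondCountableTopology X] [ConnectedSpace X] (D : InitialDataSet (𝓡 3) X), (∀ 𝓑, Q 𝓑 → Q' 𝓑) → SettlesWith Q X D → SettlesWith Q' X D := by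
  intro Q Q' X _ _ _ _ _ _ D hQQ' h 𝒟 h𝒟
  obtain ⟨hcni, O, d, hO, hex, hholes⟩ := h 𝒟 h𝒟
  exact ⟨hcni, O, d, hO, hex, fun i ↦ ⟨(hholes i).1, (hholes i).2.1, (hholes i).2.2.1,
    hQQ' _ (hholes i).2.2.2⟩⟩

/-- **Settling to mode-stable regular holes is settling regularly** (`SettlesWith (fun _ ↦ True)` is
the "settles regularly" of the composition's case split). [folklore] -/
theorem settlesWith_true_of_settlesWith_modeStable : ∀ (X : Type) [TopologicalSpace X] [ChartedSpace E3 X] [IsManifold (𝓡 3) ∞ X] [T2Space X] [SecondCountableTopology X] [ConnectedSpace X] (D : InitialDataSet (𝓡 3) X), SettlesWith ModeStable X D → SettlesWith (fun _ ↦ True) X D := by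
  intro X _ _ _ _ _ _ D h
  exact settlesWith_mono ModeStable (fun _ ↦ True) X D (fun _ _ ↦ trivial) h

/-- **`k = 0` is not a loophole of `stub_dualModeEjection`**: a curve whose members lie in the range
of a `0`-parameter family (a single datum) is constant, hence not injective on any parameter ball
`|c 0| < ε`, `ε > 0`; so every proof of the stub must produce `k ≥ 1` detectors. [folklore] -/
theorem not_injOn_ball_of_forall_mem_range_fin0 : ∀ (X : Type) [TopologicalSpace X] [ChartedSpace E3 X] [IsManifold (𝓡 3) ∞ X] (ε : ℝ) (F : EuclideanSpace ℝ (Fin 1) → InitialDataSet (𝓡 3) X) (G : EuclideanSpace ℝ (Fin 0) → InitialDataSet (𝓡 3) X), 0 < ε → (∀ c, ∃ c', F c = G c') → ¬ (∀ c c' : EuclideanSpace ℝ (Fin 1), |c 0| < ε → |c' 0| < ε → F c = F c' → c = c') := by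
  intro X _ _ _ ε F G hε hFG hinj
  have hF : ∀ c, F c = G 0 := fun c ↦ by
    obtain ⟨c', hc'⟩ := hFG c
    rw [hc', Subsingleton.elim c' 0]
  have h0 : |(0 : EuclideanSpace ℝ (Fin 1)) 0| < ε := by simp [hε]
  have h1 : |(EuclideanSpace.single (0 : Fin 1) (ε / 2)) 0| < ε := by
    simp [abs_of_pos (half_pos hε), half_lt_self hε]
  have h2 := congrArg (fun c : EuclideanSpace ℝ (Fin 1) ↦ c 0)
    (hinj 0 _ h0 h1 ((hF 0).trans (hF _).symm))
  simp at h2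
  linarith

/-! ## §B `HasNoLocalKillingFieldNear` is a GLOBAL notion

The witness neighbourhood `V` of the definition may be taken to be the whole slice: the predicate is
implied by "no non-trivial GLOBAL Killing initial data" and refuted (at every `x₀` simultaneously) by
one densely non-vanishing global Killing field of the development. Classically (unique continuation
of Killing fields) the two brackets coincide, so `HasNoLocalKillingFieldNear 𝒟 x₀` does not depend on
`x₀` and does NOT express the absence of LOCAL Killing initial data near `x₀` (data exactly Kerr
outside a compact set have local KIDs far out, yet satisfy it everywhere when they have no global KID). -/

/-- **`HasNoLocalKillingFieldNear` is implied by GLOBAL Killing-freeness** (witness `V = univ`): if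
every vector field which is smooth and Killing on an open neighbourhood of the whole Cauchy surface
vanishes on it, then `HasNoLocalKillingFieldNear 𝒟 x₀` holds at EVERY `x₀`. [folklore] -/
theorem hasNoLocalKillingFieldNear_of_global : ∀ (X : Type) [TopologicalSpace X] [ChartedSpace E3 X] [IsManifold (𝓡 3) ∞ X] [ConnectedSpace X] (D : InitialDataSet (𝓡 3) X) (𝒟 : VacuumCauchyDevelopment D), (haveI : 𝒟.metric.toPseudoRiemannianMetric.HasLeviCivita := 𝒟.metric.hasLeviCivita; ∀ (W : Set 𝒟.carrier), IsOpen W → Set.range 𝒟.embed ⊆ W → ∀ ξ : (p : 𝒟.carrier) → TangentSpace (𝓡 4) p, ContMDiffOn (𝓡 4) ((𝓡 4).prod 𝓘(ℝ, E4)) ∞ (fun p ↦ (TotalSpace.mk' E4 p (ξ p) : TangentBundle (𝓡 4) 𝒟.carrier)) W → (∀ p ∈ W, ∀ Y₀ Z₀ : TangentSpace (𝓡 4) p, 𝒟.metric.val p (𝒟.metric.toPseudoRiemannianMetric.leviCivita ξ p Y₀) Z₀ + 𝒟.metric.val p Y₀ (𝒟.metric.toPseudoRiemannianMetric.leviCivita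 ξ p Z₀) = 0) → ∀ x, ξ (𝒟.embed x) = 0) → ∀ x₀ : X, HasNoLocalKillingFieldNear 𝒟 x₀ := by
  intro X _ _ _ _ D 𝒟 h x₀
  refine ⟨Set.univ, isOpen_univ, Set.mem_univ _, fun W hW hVW ξ hξ hK x _ ↦ ?_⟩
  exact h W hW (by simpa [Set.image_univ] using hVW) ξ hξ hK x

/-- **One densely non-vanishing global Killing field refutes `HasNoLocalKillingFieldNear` at every
point**: if a vector field is smooth and Killing on an open neighbourhood of the Cauchy surface and
non-zero at `ι(x)` for a dense set of `x` (classically: ANY non-trivial Killing field of the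
development, e.g. the axial field of an axisymmetric datum), then no `x₀` satisfies
`HasNoLocalKillingFieldNear 𝒟 x₀`. [folklore] -/
theorem not_hasNoLocalKillingFieldNear_of_killing : ∀ (X : Type) [TopologicalSpace X] [ChartedSpace E3 X] [IsManifold (𝓡 3) ∞ X] [ConnectedSpace X] (D : InitialDataSet (𝓡 3) X) (𝒟 : VacuumCauchyDevelopment D), (haveI : 𝒟.metric.toPseudoRiemannianMetric.HasLeviCivita := 𝒟.metric.hasLeviCivita; ∃ (W : Set 𝒟.carrier) (ξ : (p : 𝒟.carrier) → TangentSpace (𝓡 4) p), IsOpen W ∧ Set.range 𝒟.embed ⊆ W ∧ ContMDiffOn (𝓡 4) ((𝓡 4).prod 𝓘(ℝ, E4)) ∞ (fun p ↦ (TotalSpace.mk' E4 p (ξ p) : TangentBundle (𝓡 4) 𝒟.carrier)) W ∧ (∀ p ∈ W, ∀ Y₀ Z₀ : TangentSpace (𝓡 4) p, 𝒟.metric.val p (𝒟.metric.toPseudoRiemannianMetric.leviCivita ξ p Y₀) Z₀ + 𝒟.metric.val p Y₀ (𝒟.metric.toPseudoRiemannianMetric.leviCivita ξ p Z₀) = 0)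 ∧ ∀ V : Set X, IsOpen V → V.Nonempty → ∃ x ∈ V, ξ (𝒟.embed x) ≠ 0) → ∀ x₀ : X, ¬ HasNoLocalKillingFieldNear 𝒟 x₀ := by
  intro X _ _ _ _ D 𝒟 h x₀
  rintro ⟨V, hV, hx₀, hkill⟩
  obtain ⟨W, ξ, hW, hrange, hξ, hK, hdense⟩ := h
  obtain ⟨x, hxV, hx⟩ := hdense V hV ⟨x₀, hx₀⟩
  exact hx (hkill W hW ((Set.image_subset_range _ _).trans hrange) ξ hξ hK x hxV)

/-! ## §C The antisymmetric-detector collapse of the registered statement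

`AreDetectorsAt` does not ask the detectors to be SYMMETRIC forms. An antisymmetric detector `(A, 0)`
is automatically "non-gauge" (slice tangents are `s`-derivatives of the symmetric tensors `ι_s^* g`,
`K_s`), and it pairs to ZERO with the (symmetric) tangents of every family of data, so
`det (pairingMatrix …) ≠ 0` is never met and the steering clause of the stub is VACUOUS. Hence the
registered statement is implied by — so, being trivially stronger, EQUIVALENT to — the bare claim
"under the hypotheses some point of the slice satisfies `HasNoLocalKillingFieldNear`" (§B: no global
Killing initial data): `stub_dualModeEjection_of_kidFree`, `kidFree_of_stub_dualModeEjection`. -/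

section Collapse

variable {X : Type} [TopologicalSpace X] [ChartedSpace E3 X] [IsManifold (𝓡 3) ∞ X]

/-- Coordinates in the trivialisation at `x₀` of the bundle of bilinear forms on `TX`: over a point
`x` of its base set a form `φ` reads `(v, w) ↦ φ (e₁.symmL x v) (e₁.symmL x w)`, `e₁` the tangent
bundle trivialisation at `x₀` (Mathlib's `hom_trivializationAt_apply` twice, and the identity
trivialisation of the trivial bundle `ℝ`). [folklore] -/
private theorem bilinTrivializationAt_apply₂ (x₀ x : X)
    (hx : x ∈ (trivializationAt (E3 →L[ℝ] E3 →L[ℝ] ℝ)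
      (fun x : X ↦ TangentSpace (𝓡 3) x →L[ℝ] TangentSpace (𝓡 3) x →L[ℝ] ℝ) x₀).baseSet)
    (φ : TangentSpace (𝓡 3) x →L[ℝ] TangentSpace (𝓡 3) x →L[ℝ] ℝ) (v w : E3) :
    (trivializationAt (E3 →L[ℝ] E3 →L[ℝ] ℝ)
      (fun x : X ↦ TangentSpace (𝓡 3) x →L[ℝ] TangentSpace (𝓡 3) x →L[ℝ] ℝ) x₀ ⟨x, φ⟩).2 v w =
      φ ((trivializationAt E3 (TangentSpace (𝓡 3) : X → Type) x₀).symmL ℝ x v)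
        ((trivializationAt E3 (TangentSpace (𝓡 3) : X → Type) x₀).symmL ℝ x w) := by
  rw [hom_trivializationAt_baseSet] at hx
  rw [hom_trivializationAt_apply]
  simp only [ContinuousLinearMap.inCoordinates, ContinuousLinearMap.coe_comp, Function.comp_apply]
  rw [Trivialization.continuousLinearMapAt_apply_of_mem (R := ℝ) (hb := hx.2),
    hom_trivializationAt_apply]
  simp only [ContinuousLinearMap.inCoordinates, ContinuousLinearMap.coe_comp, Function.comp_apply]
  have key : ∀ r : ℝ,
      Trivialization.continuousLinearMapAt ℝ (trivializationAt ℝ (Bundle.Trivial X ℝ) x₀) x r = r := by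
    intro r
    rw [Trivialization.continuousLinearMapAt_apply_of_mem (R := ℝ) (hb := Set.mem_univ x)]
    rfl
  exact key _

/-- **A smooth field of bilinear forms near `x₀` with prescribed constant coordinates**: the field
`x ↦ om ∘ (e₁(x) × e₁(x))`, `e₁` the tangent bundle trivialisation at `x₀`, is smooth on the base set
of the trivialisation at `x₀` of the bundle of bilinear forms (its coordinates there are the
constant `om`). [folklore] -/
theorem smoothBilinOn_precomp_comp_trivializationAt : ∀ (X : Type) [TopologicalSpace X] [ChartedSpace E3 X] [IsManifold (𝓡 3) ∞ X] (om : E3 →L[ℝ] E3 →L[ℝ] ℝ) (x₀ : X), SmoothBilinOn (fun x : X ↦ (ContinuousLinearMap.precomp ℝ ((trivializationAt E3 (TangentSpace (𝓡 3) : X → Type) x₀).continuousLinearMapAt ℝ x)).comp (om.comp ((trivializationAt E3 (TangentSpace (𝓡 3) : X → Type) x₀).continuousLinearMapAt ℝ x))) (trivializationAt (E3 →L[ℝ] E3 →L[ℝ] ℝ) (fun x : X ↦ TangentSpace (𝓡 3) x →L[ℝ] TangentSpace (𝓡 3) x →L[ℝ] ℝ) x₀).baseSet := by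
  intro X _ _ _ om x₀
  unfold SmoothBilinOn
  rw [Trivialization.contMDiffOn_section_baseSet_iff]
  apply (contMDiffOn_const (c := om)).congr
  intro x hx
  have hx₁ : x ∈ (trivializationAt E3 (TangentSpace (𝓡 3) : X → Type) x₀).baseSet := by
    rw [hom_trivializationAt_baseSet] at hx
    exact hx.1
  ext v w
  rw [bilinTrivializationAt_apply₂ x₀ x hx]
  simp only [ContinuousLinearMap.comp_apply, ContinuousLinearMap.precomp_apply,
    Trivialization.continuousLinearMapAt_symmL _ hx₁]

/-- Derivatives of curves of symmetric forms are symmetric (including the junk value `0` at a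
non-differentiable parameter). [folklore] -/
private theorem deriv_apply₂_symm_of_forall (f : ℝ → (E3 →L[ℝ] E3 →L[ℝ] ℝ)) (v w : E3)
    (h : ∀ s, f s v w = f s w v) : deriv f 0 v w = deriv f 0 w v := by
  by_cases hf : DifferentiableAt ℝ f 0
  · have h1 : ∀ u : E3, deriv (fun s ↦ f s u) 0 = deriv f 0 u := fun u ↦ by
      rw [deriv_clm_apply hf (differentiableAt_const u), deriv_const, map_zero, add_zero]
    have h2 : ∀ u u' : E3, deriv (fun s ↦ f s u u') 0 = deriv f 0 u u' := fun u u' ↦ by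
      have hfu : DifferentiableAt ℝ (fun s ↦ f s u) 0 := hf.clm_apply (differentiableAt_const u)
      rw [deriv_clm_apply hfu (differentiableAt_const u'), deriv_const, map_zero, add_zero, h1]
    rw [← h2, ← h2]
    exact congrArg (fun g : ℝ → ℝ ↦ deriv g 0) (funext h)
  · rw [deriv_zero_of_not_differentiableAt hf]
    rfl

/-- **The metric tangent `∂_j h_c|₀` of a family of data is a symmetric form.** [folklore] -/
theorem famTangentH_symm : ∀ (X : Type) [TopologicalSpace X] [ChartedSpace E3 X] [IsManifold (𝓡 3) ∞ X] (k : ℕ) (G : EuclideanSpace ℝ (Fin k) → InitialDataSet (𝓡 3) X) (j : Fin k) (x : X) (v w : TangentSpace (𝓡 3) x), famTangentH G j x v w = famTangentH G j x w v :=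
  fun _ _ _ _ _ G j x v w ↦
    deriv_apply₂_symm_of_forall _ v w fun s ↦ (G (EuclideanSpace.single j s)).h.symm x v w

/-- **The extrinsic tangent `∂_j k_c|₀` of a family of data is a symmetric form.** [folklore] -/
theorem famTangentK_symm : ∀ (X : Type) [TopologicalSpace X] [ChartedSpace E3 X] [IsManifold (𝓡 3) ∞ X] (k : ℕ) (G : EuclideanSpace ℝ (Fin k) → InitialDataSet (𝓡 3) X) (j : Fin k) (x : X) (v w : TangentSpace (𝓡 3) x), famTangentK G j x v w = famTangentK G j x w v :=
  fun _ _ _ _ _ G j x v w ↦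
    deriv_apply₂_symm_of_forall _ v w fun s ↦ (G (EuclideanSpace.single j s)).k_symm x v w

/-- **`S_{ij} T^{ij} = 0` for `S` symmetric and `T` antisymmetric** (`symInner`; the tree's
`trace_sharp_comp_sharp_of_add_flip_eq` with `c = 0`). [folklore] -/
theorem symInner_eq_zero_of_symm_of_antisymm : ∀ (X : Type) [TopologicalSpace X] [ChartedSpace E3 X] [IsManifold (𝓡 3) ∞ X] (D : InitialDataSet (𝓡 3) X) (x : X) (S T : TangentSpace (𝓡 3) x →L[ℝ] TangentSpace (𝓡 3) x →L[ℝ] ℝ), (∀ v w, S v w = S w v) → (∀ v w, T v w = -T w v) → symInner D x S T = 0 := by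
  intro X _ _ _ D x S T hS hT
  unfold symInner
  have hK : S.toLinearMap₁₂.flip = S.toLinearMap₁₂ := by
    ext v w
    simp [LinearMap.flip_apply, hS w v]
  have hB : T.toLinearMap₁₂.flip + T.toLinearMap₁₂.flip.flip = (0 : ℝ) • S.toLinearMap₁₂ := by
    ext v w
    simp [LinearMap.flip_apply, hT v w]
  have := D.metric.trace_sharp_comp_sharp_of_add_flip_eq x hK hB
  simpa using this

/-- `symInner(0, T) = 0`. [folklore] -/
private theorem symInner_zero_left (D : InitialDataSet (𝓡 3) X) (x : X)
    (T : TangentSpace (𝓡 3) x →L[ℝ] TangentSpace (𝓡 3) x →L[ℝ] ℝ) : symInner D x 0 T = 0 := by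
  unfold symInner
  have h0 : (0 : TangentSpace (𝓡 3) x →L[ℝ] TangentSpace (𝓡 3) x →L[ℝ] ℝ).toLinearMap₁₂ = 0 := by
    ext v w
    rfl
  rw [h0, LinearMap.comp_zero, LinearMap.zero_comp, map_zero]

/-- `hTrace 0 = 0`. [folklore] -/
private theorem hTrace_zero (D : InitialDataSet (𝓡 3) X) (x : X) : hTrace D x 0 = 0 := by
  unfold hTrace PseudoRiemannianMetric.trace
  have h0 : (0 : TangentSpace (𝓡 3) x →L[ℝ] TangentSpace (𝓡 3) x →L[ℝ] ℝ).toLinearMap₁₂ = 0 := by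
    ext v w
    rfl
  rw [h0, LinearMap.comp_zero, map_zero]

/-- **`h^{ij} T_{ij} = 0` for `T` antisymmetric** (`tr ♯T = tr (♯T)† = tr ♯Tᵗ = −tr ♯T`). [folklore] -/
theorem hTrace_eq_zero_of_antisymm : ∀ (X : Type) [TopologicalSpace X] [ChartedSpace E3 X] [IsManifold (𝓡 3) ∞ X] (D : InitialDataSet (𝓡 3) X) (x : X) (T : TangentSpace (𝓡 3) x →L[ℝ] TangentSpace (𝓡 3) x →L[ℝ] ℝ), (∀ v w, T v w = -T w v) → hTrace D x T = 0 := by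
  intro X _ _ _ D x T hT
  unfold hTrace PseudoRiemannianMetric.trace
  have hflip : LinearMap.BilinForm.flip T.toLinearMap₁₂ = -T.toLinearMap₁₂ := by
    ext v w
    simp [hT w v]
  have h1 := D.metric.trace_adjoint x ((D.metric.sharp x).toLinearMap ∘ₗ T.toLinearMap₁₂)
  rw [D.metric.adjoint_sharp_comp x T.toLinearMap₁₂, hflip, LinearMap.comp_neg, map_neg] at h1
  linarith

/-- **Antisymmetric detectors pair to zero**: the ADM symplectic density of an antisymmetric `A`
(with `B = 0`) against any `(a, b)` with `b` symmetric vanishes identically. [folklore] -/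
theorem omegaDensity_eq_zero_of_antisymm : ∀ (X : Type) [TopologicalSpace X] [ChartedSpace E3 X] [IsManifold (𝓡 3) ∞ X] (D : InitialDataSet (𝓡 3) X) (A a b : BilinField X) (x : X), (∀ v w, A x v w = -A x w v) → (∀ v w, b x v w = b x w v) → omegaDensity D A 0 a b x = 0 := by
  intro X _ _ _ D A a b x hA hb
  unfold omegaDensity
  rw [Pi.zero_apply, symInner_zero_left, hTrace_zero, hTrace_eq_zero_of_antisymm X D x (A x) hA,
    symInner_eq_zero_of_symm_of_antisymm X D x (b x) (A x) hb hA,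
    symInner_eq_zero_of_symm_of_antisymm X D x (D.k x) (A x) (D.k_symm x) hA]
  ring

/-- **The pairing matrix of one antisymmetric detector `(A₀, 0)` is singular** (it is the `1 × 1`
zero matrix), whatever the family `G`. [folklore] -/
theorem det_pairingMatrix_eq_zero_of_antisymm : ∀ (X : Type) [TopologicalSpace X] [ChartedSpace E3 X] [IsManifold (𝓡 3) ∞ X] (D : InitialDataSet (𝓡 3) X) (x₀ : X) (A₀ : BilinField X), (∀ x v w, A₀ x v w = -A₀ x w v) → ∀ G : EuclideanSpace ℝ (Fin 1) → InitialDataSet (𝓡 3) X, (pairingMatrix D x₀ (fun _ : Fin 1 ↦ A₀) (fun _ ↦ (0 : BilinField X)) G).det = 0 := by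
  intro X _ _ _ D x₀ A₀ hA G
  rw [Matrix.det_fin_one]
  show chartPairing D x₀ A₀ 0 (famTangentH G 0) (famTangentK G 0) = 0
  unfold chartPairing
  have h : ∀ x, omegaDensity D A₀ 0 (famTangentH G 0) (famTangentK G 0) x = 0 := fun x ↦
    omegaDensity_eq_zero_of_antisymm X D A₀ _ _ x (hA x) (famTangentK_symm X 1 G 0 x)
  simp [h]

/-- **An antisymmetric pair `(A, B)` with `A x₀ ≠ 0` is never a local slice tangent at `x₀`**: slice
tangents are `s`-derivatives of the symmetric forms `ι_s^* g`. [folklore] -/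
theorem not_isLocalSliceTangentAt_of_antisymm : ∀ (X : Type) [TopologicalSpace X] [ChartedSpace E3 X] [IsManifold (𝓡 3) ∞ X] [ConnectedSpace X] (D : InitialDataSet (𝓡 3) X) (𝒟 : VacuumCauchyDevelopment D) (A B : BilinField X) (x₀ : X), (∀ v w, A x₀ v w = -A x₀ w v) → A x₀ ≠ 0 → ¬ IsLocalSliceTangentAt 𝒟 A B x₀ := by
  intro X _ _ _ _ D 𝒟 A B x₀ hA hne
  rintro ⟨V, δ, -, hx₀, -, ι, ν, -, -, -, hderiv⟩
  apply hne
  ext v w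
  have h1 := (hderiv x₀ hx₀ v w).1
  have h2 := (hderiv x₀ hx₀ w v).1
  have hsym : (fun s : ℝ ↦ pullbackBilin (I := 𝓡 4) (I' := 𝓡 3) (ι s) 𝒟.metric.val x₀ w v) =
      fun s ↦ pullbackBilin (I := 𝓡 4) (I' := 𝓡 3) (ι s) 𝒟.metric.val x₀ v w := by
    funext s
    simp only [pullbackBilin_apply]
    exact 𝒟.metric.symm _ _ _
  rw [hsym] at h2
  have h3 := h1.unique h2
  have h4 := hA v w
  show A x₀ v w = 0
  linarith

/-- **Antisymmetric detectors exist at every point satisfying `HasNoLocalKillingFieldNear`**: the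
field `A₀ = om ∘ (e₁ × e₁)`, `om(v, w) = v₀ w₁ − v₁ w₀`, `e₁` the tangent trivialisation at `x₀`, is
antisymmetric everywhere, smooth near `x₀`, non-zero at `x₀`, and `(A₀, 0)` satisfies
`AreDetectorsAt 𝒟 x₀` (no multiple `a • A₀`, `a ≠ 0`, is a slice tangent). [folklore] -/
theorem exists_antisymm_areDetectorsAt : ∀ (X : Type) [TopologicalSpace X] [ChartedSpace E3 X] [IsManifold (𝓡 3) ∞ X] [ConnectedSpace X] (D : InitialDataSet (𝓡 3) X) (𝒟 : VacuumCauchyDevelopment D) (x₀ : X), HasNoLocalKillingFieldNear 𝒟 x₀ → ∃ A₀ : BilinField X, (∀ x v w, A₀ x v w = -A₀ x w v) ∧ AreDetectorsAt 𝒟 x₀ (fun _ : Fin 1 ↦ A₀) (fun _ ↦ (0 : BilinField X)) := by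
  intro X _ _ _ _ D 𝒟 x₀ hx₀
  set e₁ := trivializationAt E3 (TangentSpace (𝓡 3) : X → Type) x₀ with he₁
  set om : E3 →L[ℝ] E3 →L[ℝ] ℝ :=
    (ContinuousLinearMap.mul ℝ ℝ).bilinearComp (EuclideanSpace.proj (0 : Fin 3))
        (EuclideanSpace.proj (1 : Fin 3)) -
      (ContinuousLinearMap.mul ℝ ℝ).bilinearComp (EuclideanSpace.proj (1 : Fin 3))
        (EuclideanSpace.proj (0 : Fin 3)) with hom
  have homapp : ∀ v w : E3, om v w = v 0 * w 1 - v 1 * w 0 := fun v w ↦ by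
    simp [hom, ContinuousLinearMap.bilinearComp_apply]
  set A₀ : BilinField X := fun x ↦ (ContinuousLinearMap.precomp ℝ (e₁.continuousLinearMapAt ℝ x)).comp
    (om.comp (e₁.continuousLinearMapAt ℝ x)) with hA₀
  have hA₀app : ∀ x v w, A₀ x v w =
      om (e₁.continuousLinearMapAt ℝ x v) (e₁.continuousLinearMapAt ℝ x w) := fun x v w ↦ by
    simp only [hA₀, ContinuousLinearMap.comp_apply, ContinuousLinearMap.precomp_apply]
  have hanti : ∀ x v w, A₀ x v w = -A₀ x w v := fun x v w ↦ by
    rw [hA₀app, hA₀app, homapp, homapp]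
    ring
  have hb₁ : x₀ ∈ e₁.baseSet := FiberBundle.mem_baseSet_trivializationAt E3 _ x₀
  have hne : A₀ x₀ ≠ 0 := by
    intro h
    have := congrArg (fun T : TangentSpace (𝓡 3) x₀ →L[ℝ] TangentSpace (𝓡 3) x₀ →L[ℝ] ℝ ↦
      T (e₁.symmL ℝ x₀ (EuclideanSpace.single (0 : Fin 3) (1 : ℝ)))
        (e₁.symmL ℝ x₀ (EuclideanSpace.single (1 : Fin 3) (1 : ℝ)))) h
    simp only [hA₀app, e₁.continuousLinearMapAt_symmL hb₁, homapp] at this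
    simp at this
  refine ⟨A₀, hanti, hx₀, ?_, ?_⟩
  · -- the detector is smooth near `x₀` (and `0` is smooth)
    refine ⟨_, (trivializationAt (E3 →L[ℝ] E3 →L[ℝ] ℝ)
        (fun x : X ↦ TangentSpace (𝓡 3) x →L[ℝ] TangentSpace (𝓡 3) x →L[ℝ] ℝ) x₀).open_baseSet,
      FiberBundle.mem_baseSet_trivializationAt _ _ x₀, fun _ ↦ ⟨?_, ?_⟩⟩
    · exact smoothBilinOn_precomp_comp_trivializationAt X om x₀
    · exact (Bundle.contMDiff_zeroSection ℝ
        (fun x : X ↦ TangentSpace (𝓡 3) x →L[ℝ] TangentSpace (𝓡 3) x →L[ℝ] ℝ)).contMDiffOn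
  · -- no non-trivial multiple is a local slice tangent: it is antisymmetric and non-zero at `x₀`
    intro a ha
    have ha0 : a 0 ≠ 0 := fun h ↦ ha (funext fun j ↦ by
      rw [Subsingleton.elim j 0, h]
      rfl)
    refine not_isLocalSliceTangentAt_of_antisymm X D 𝒟 _ _ x₀ (fun v w ↦ ?_) ?_
    · show (∑ j : Fin 1, a j • A₀ x₀) v w = -((∑ j : Fin 1, a j • A₀ x₀) w v)
      rw [Fin.sum_univ_one]
      show a 0 * A₀ x₀ v w = -(a 0 * A₀ x₀ w v)
      rw [hanti x₀ v w]
      ring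
    · show (∑ j : Fin 1, a j • A₀ x₀) ≠ 0
      rw [Fin.sum_univ_one]
      exact smul_ne_zero ha0 hne

/-- **The collapse.** If, under the hypotheses of `stub_dualModeEjection`, SOME point of the slice
satisfies `HasNoLocalKillingFieldNear`, then the registered statement holds — with `k = 1`, the
antisymmetric detector `(A₀, 0)` of `exists_antisymm_areDetectorsAt`, and a VACUOUS steering clause
(its pairing matrix is singular for every family `G`). No dynamics (no dual mode, no saddle, no
fate) is used: the content of the registered statement is exactly the Killing-freeness claim.
[folklore] -/
theorem stub_dualModeEjection_of_kidFree : (∀ (X : Type) [TopologicalSpace X] [ChartedSpace E3 X] [IsManifold (𝓡 3) ∞ X] [T2Space X] [SecondCountableTopology X] [ConnectedSpace X], ∀ D ∈ admissibleVacuumData X, ∀ (𝒟 : VacuumCauchyDevelopment D), 𝒟.IsMaximal → Summit.FinalStateConjecture.HasCompleteNullInfinity 𝒟.toCauchyDevelopment → ∀ (O : Set 𝒟.carrier) (d : StationaryFinalStateDecomposition 𝒟.toSpacetime O 2), O = Summit.FinalStateConjecture.exteriorOf 𝒟.toCauchyDevelopment d.charted → d.HasExhaustiveCharts → (∀ i,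 (d.hole i).horizon ⊆ Set.range (d.adapted i).toFun ∧ ChartIsAsymptoticallyCartesian (d.adapted i) ∧ InTelescope (d.hole i)) → ∀ (i : Fin d.N) (ν ϖ : ℝ) (h₁ h₂ : HoleBilinField (d.hole i)), 0 < ν → IsGravitationalModePair (d.hole i) (d.adapted i) ν ϖ h₁ h₂ → ∃ x₀ : X, HasNoLocalKillingFieldNear 𝒟 x₀) → ∀ (X : Type) [TopologicalSpace X] [ChartedSpace E3 X] [IsManifold (𝓡 3) ∞ X] [T2Space X] [SecondCountableTopology X] [ConnectedSpace X], ∀ D ∈ admissibleVacuumData X, ∀ (𝒟 : VacuumCauchyDevelopment D), 𝒟.IsMaximal → Summit.FinalStateConjecture.HasCompleteNullInfinity 𝒟.toCauchyDevelopment → ∀ (O : Set 𝒟.carrier) (d : StationaryFinalStateDecomposition 𝒟.toSpacetime O 2), O = Summit.FinalStateConjecture.exteriorOf 𝒟.toCauchyDevelopment d.charted → d.HasExhaustiveCharts → (∀ i, (d.hole i).horizon ⊆ Set.range (d.adapted i).toFun ∧ ChartIsAsymptoticallyCartesian (d.adapted i) ∧ InTelescope (d.hole i)) → ∀ (i : Fin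 d.N) (ν ϖ : ℝ) (h₁ h₂ : HoleBilinField (d.hole i)), 0 < ν → IsGravitationalModePair (d.hole i) (d.adapted i) ν ϖ h₁ h₂ → ∃ (x₀ : X) (k : ℕ) (A B : Fin k → BilinField X), AreDetectorsAt 𝒟 x₀ A B ∧ ∀ G : EuclideanSpace ℝ (Fin k) → InitialDataSet (𝓡 3) X, InitialDataSet.IsSmoothDataFamily k G → G 0 = D → (∀ c, G c ∈ admissibleVacuumData X) → (∃ K : Set X, IsCompact K ∧ K ⊆ (extChartAt (𝓡 3) x₀).source ∧ IsSupportedIn D G K) → (pairingMatrix D x₀ A B G).det ≠ 0 → ∃ (ε : ℝ) (F : EuclideanSpace ℝ (Fin 1) → InitialDataSet (𝓡 3) X), 0 < ε ∧ InitialDataSet.IsSmoothDataFamily 1 F ∧ F 0 = D ∧ (∀ c, ∃ c', F c = G c') ∧ (∀ c c' : EuclideanSpace ℝ (Fin 1), |c 0| < ε → |c' 0| < ε → F c = F c' → c = c') ∧ ∀ c : EuclideanSpace ℝ (Fin 1), c ≠ 0 → |c 0| < ε → SettlesWith ModeStable X (F c) := by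
  intro hKID X _ _ _ _ _ _ D hD 𝒟 h𝒟 hcni O d hO hex hreg i ν ϖ h₁ h₂ hν hmode
  obtain ⟨x₀, hx₀⟩ := hKID X D hD 𝒟 h𝒟 hcni O d hO hex hreg i ν ϖ h₁ h₂ hν hmode
  obtain ⟨A₀, hanti, hdet⟩ := exists_antisymm_areDetectorsAt X D 𝒟 x₀ hx₀
  refine ⟨x₀, 1, fun _ ↦ A₀, fun _ ↦ 0, hdet, fun G _ _ _ _ hG ↦ ?_⟩
  exact absurd (det_pairingMatrix_eq_zero_of_antisymm X D x₀ A₀ hanti G) hG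

/-- Conversely (trivially), the registered statement yields the Killing-freeness claim. [folklore] -/
theorem kidFree_of_stub_dualModeEjection : (∀ (X : Type) [TopologicalSpace X] [ChartedSpace E3 X] [IsManifold (𝓡 3) ∞ X] [T2Space X] [SecondCountableTopology X] [ConnectedSpace X], ∀ D ∈ admissibleVacuumData X, ∀ (𝒟 : VacuumCauchyDevelopment D), 𝒟.IsMaximal → Summit.FinalStateConjecture.HasCompleteNullInfinity 𝒟.toCauchyDevelopment → ∀ (O : Set 𝒟.carrier) (d : StationaryFinalStateDecomposition 𝒟.toSpacetime O 2), O = Summit.FinalStateConjecture.exteriorOf 𝒟.toCauchyDevelopment d.charted → d.HasExhaustiveCharts → (∀ i, (d.hole i).horizon ⊆ Set.range (d.adapted i).toFun ∧ ChartIsAsymptoticallyCartesian (d.adapted i) ∧ InTelescope (d.hole i)) → ∀ (i : Fin d.N) (ν ϖ : ℝ) (h₁ h₂ : HoleBilinField (d.hole i)), 0 < ν → IsGravitationalModePair (d.hole i) (d.adapted i) ν ϖ h₁ h₂ → ∃ (x₀ : X) (k : ℕ) (A B : Fin k → BilinField X), AreDetectorsAt 𝒟 x₀ A B ∧ ∀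 G : EuclideanSpace ℝ (Fin k) → InitialDataSet (𝓡 3) X, InitialDataSet.IsSmoothDataFamily k G → G 0 = D → (∀ c, G c ∈ admissibleVacuumData X) → (∃ K : Set X, IsCompact K ∧ K ⊆ (extChartAt (𝓡 3) x₀).source ∧ IsSupportedIn D G K) → (pairingMatrix D x₀ A B G).det ≠ 0 → ∃ (ε : ℝ) (F : EuclideanSpace ℝ (Fin 1) → InitialDataSet (𝓡 3) X), 0 < ε ∧ InitialDataSet.IsSmoothDataFamily 1 F ∧ F 0 = D ∧ (∀ c, ∃ c', F c = G c') ∧ (∀ c c' : EuclideanSpace ℝ (Fin 1), |c 0| < ε → |c' 0| < ε → F c = F c' → c = c') ∧ ∀ c : EuclideanSpace ℝ (Fin 1), c ≠ 0 → |c 0| < ε → SettlesWith ModeStable X (F c)) → ∀ (X : Type) [TopologicalSpace X] [ChartedSpace E3 X] [IsManifold (𝓡 3) ∞ X] [T2Space X] [SecondCountableTopology X] [ConnectedSpace X], ∀ D ∈ admissibleVacuumData X, ∀ (𝒟 : VacuumCauchyDevelopment D), 𝒟.IsMaximal → Summit.FinalStateConjecture.HasCompleteNullInfinity 𝒟.toCauchyDevelopment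 → ∀ (O : Set 𝒟.carrier) (d : StationaryFinalStateDecomposition 𝒟.toSpacetime O 2), O = Summit.FinalStateConjecture.exteriorOf 𝒟.toCauchyDevelopment d.charted → d.HasExhaustiveCharts → (∀ i, (d.hole i).horizon ⊆ Set.range (d.adapted i).toFun ∧ ChartIsAsymptoticallyCartesian (d.adapted i) ∧ InTelescope (d.hole i)) → ∀ (i : Fin d.N) (ν ϖ : ℝ) (h₁ h₂ : HoleBilinField (d.hole i)), 0 < ν → IsGravitationalModePair (d.hole i) (d.adapted i) ν ϖ h₁ h₂ → ∃ x₀ : X, HasNoLocalKillingFieldNear 𝒟 x₀ := by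
  intro hE X _ _ _ _ _ _ D hD 𝒟 h𝒟 hcni O d hO hex hreg i ν ϖ h₁ h₂ hν hmode
  obtain ⟨x₀, k, A, B, hdet, -⟩ := hE X D hD 𝒟 h𝒟 hcni O d hO hex hreg i ν ϖ h₁ h₂ hν hmode
  exact ⟨x₀, hdet.1⟩

/-- **Counter-instance shape (the symmetric bomb).** If some admissible datum has an MGHD with
complete `𝓘⁺` and an exhaustive regular stationary decomposition one of whose holes carries a
growing gravitational Killing-mode pair, AND that development carries a Killing field, smooth on an
open neighbourhood of the Cauchy surface and non-zero at `ι(x)` for a dense set of `x` (an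
axisymmetric datum settling to an axisymmetric bomb), then the registered statement is FALSE: its
conclusion `HasNoLocalKillingFieldNear 𝒟 x₀` fails at every `x₀`. [folklore] -/
theorem stub_dualModeEjection_false_of_symmetricBomb : (∃ (X : Type) (_ : TopologicalSpace X) (_ : ChartedSpace E3 X) (_ : IsManifold (𝓡 3) ∞ X) (_ : T2Space X) (_ : SecondCountableTopology X) (_ : ConnectedSpace X) (D : InitialDataSet (𝓡 3) X) (_ : D ∈ admissibleVacuumData X) (𝒟 : VacuumCauchyDevelopment D) (_ : 𝒟.IsMaximal) (_ : Summit.FinalStateConjecture.HasCompleteNullInfinity 𝒟.toCauchyDevelopment) (O : Set 𝒟.carrier) (d : StationaryFinalStateDecomposition 𝒟.toSpacetime O 2) (_ : O = Summit.FinalStateConjecture.exteriorOf 𝒟.toCauchyDevelopment d.charted) (_ : d.HasExhaustiveCharts) (_ : ∀ i, (d.hole i).horizon ⊆ Set.range (d.adapted i).toFun ∧ ChartIsAsymptoticallyCartesian (d.adapted i) ∧ InTelescope (d.hole i)) (i : Fin d.N) (ν ϖ : ℝ) (h₁ h₂ : HoleBilinField (d.hole i)) (_ : 0 < ν) (_ :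 IsGravitationalModePair (d.hole i) (d.adapted i) ν ϖ h₁ h₂), haveI : 𝒟.metric.toPseudoRiemannianMetric.HasLeviCivita := 𝒟.metric.hasLeviCivita; ∃ (W : Set 𝒟.carrier) (ξ : (p : 𝒟.carrier) → TangentSpace (𝓡 4) p), IsOpen W ∧ Set.range 𝒟.embed ⊆ W ∧ ContMDiffOn (𝓡 4) ((𝓡 4).prod 𝓘(ℝ, E4)) ∞ (fun p ↦ (TotalSpace.mk' E4 p (ξ p) : TangentBundle (𝓡 4) 𝒟.carrier)) W ∧ (∀ p ∈ W, ∀ Y₀ Z₀ : TangentSpace (𝓡 4) p, 𝒟.metric.val p (𝒟.metric.toPseudoRiemannianMetric.leviCivita ξ p Y₀) Z₀ + 𝒟.metric.val p Y₀ (𝒟.metric.toPseudoRiemannianMetric.leviCivita ξ p Z₀) = 0) ∧ ∀ V : Set X, IsOpen V → V.Nonempty → ∃ x ∈ V, ξ (𝒟.embed x) ≠ 0) → ¬ (∀ (X : Type) [TopologicalSpace X] [ChartedSpace E3 X] [IsManifold (𝓡 3) ∞ X] [T2Space X] [SecondCountableTopology X] [ConnectedSpace X], ∀ D ∈ admissibleVacuumData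 X, ∀ (𝒟 : VacuumCauchyDevelopment D), 𝒟.IsMaximal → Summit.FinalStateConjecture.HasCompleteNullInfinity 𝒟.toCauchyDevelopment → ∀ (O : Set 𝒟.carrier) (d : StationaryFinalStateDecomposition 𝒟.toSpacetime O 2), O = Summit.FinalStateConjecture.exteriorOf 𝒟.toCauchyDevelopment d.charted → d.HasExhaustiveCharts → (∀ i, (d.hole i).horizon ⊆ Set.range (d.adapted i).toFun ∧ ChartIsAsymptoticallyCartesian (d.adapted i) ∧ InTelescope (d.hole i)) → ∀ (i : Fin d.N) (ν ϖ : ℝ) (h₁ h₂ : HoleBilinField (d.hole i)), 0 < ν → IsGravitationalModePair (d.hole i) (d.adapted i) ν ϖ h₁ h₂ → ∃ (x₀ : X) (k : ℕ) (A B : Fin k → BilinField X), AreDetectorsAt 𝒟 x₀ A B ∧ ∀ G : EuclideanSpace ℝ (Fin k) → InitialDataSet (𝓡 3) X, InitialDataSet.IsSmoothDataFamily k G → G 0 = D → (∀ c, G c ∈ admissibleVacuumData X) → (∃ K : Set X, IsCompact K ∧ K ⊆ (extChartAt (𝓡 3) x₀).source ∧ IsSupportedIn D G K) → (pairingMatrix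 D x₀ A B G).det ≠ 0 → ∃ (ε : ℝ) (F : EuclideanSpace ℝ (Fin 1) → InitialDataSet (𝓡 3) X), 0 < ε ∧ InitialDataSet.IsSmoothDataFamily 1 F ∧ F 0 = D ∧ (∀ c, ∃ c', F c = G c') ∧ (∀ c c' : EuclideanSpace ℝ (Fin 1), |c 0| < ε → |c' 0| < ε → F c = F c' → c = c') ∧ ∀ c : EuclideanSpace ℝ (Fin 1), c ≠ 0 → |c 0| < ε → SettlesWith ModeStable X (F c)) := by
  rintro ⟨X, _, _, _, _, _, _, D, hD, 𝒟, h𝒟, hcni, O, d, hO, hex, hreg, i, ν, ϖ, h₁, h₂, hν, hmode,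
    hkill⟩ hE
  obtain ⟨x₀, hx₀⟩ :=
    kidFree_of_stub_dualModeEjection hE X D hD 𝒟 h𝒟 hcni O d hO hex hreg i ν ϖ h₁ h₂ hν hmode
  exact not_hasNoLocalKillingFieldNear_of_killing X D 𝒟 hkill x₀ hx₀

end Collapse


/-! ## §E The same defect refutes the neighbour `stub_moncriefTransversality` modulo ONE Killing-free
point (recorded for the lead; the neighbour's text is quoted, not asserted)

`Sig.stub_moncriefTransversality` promises, for EVERY family of detectors satisfying `AreDetectorsAt`,
an admissible family with NON-SINGULAR pairing matrix. For the antisymmetric detector `(A₀, 0)` of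
`exists_antisymm_areDetectorsAt` the pairing matrix is singular for every family
(`det_pairingMatrix_eq_zero_of_antisymm`), so the neighbour is false as soon as ONE admissible datum
has ONE vacuum Cauchy development (not even maximal) with ONE point satisfying
`HasNoLocalKillingFieldNear` — the generic situation (Beig–Chruściel–Schoen: KIDs are non-generic).
The common repair is to demand SYMMETRIC detectors (in `AreDetectorsAt`, or in both stub texts). -/

/-- **`stub_moncriefTransversality` is false modulo one Killing-free point** (antisymmetric
detectors have singular pairing matrices against every family). [folklore] -/
theorem moncriefTransversality_false_of_kidFreePoint : (∃ (X : Type) (_ : TopologicalSpace X) (_ : ChartedSpace E3 X) (_ : IsManifold (𝓡 3) ∞ X) (_ : T2Space X) (_ : SecondCountableTopology X) (_ : ConnectedSpace X) (D : InitialDataSet (𝓡 3) X) (_ : D ∈ admissibleVacuumData X) (𝒟 : VacuumCauchyDevelopment D) (x₀ : X), HasNoLocalKillingFieldNear 𝒟 x₀) → ¬ (∀ (X : Type) [TopologicalSpace X] [ChartedSpace E3 X] [IsManifold (𝓡 3) ∞ X] [T2Space X] [SecondCountableTopology X] [ConnectedSpace X], ∀ D ∈ admissibleVacuumData X, ∀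 (𝒟 : VacuumCauchyDevelopment D) (x₀ : X) (k : ℕ) (A B : Fin k → BilinField X), AreDetectorsAt 𝒟 x₀ A B → ∀ V : Set X, IsOpen V → x₀ ∈ V → ∃ G : EuclideanSpace ℝ (Fin k) → InitialDataSet (𝓡 3) X, InitialDataSet.IsSmoothDataFamily k G ∧ G 0 = D ∧ (∀ c, G c ∈ admissibleVacuumData X) ∧ (∃ K : Set X, IsCompact K ∧ K ⊆ V ∧ K ⊆ (extChartAt (𝓡 3) x₀).source ∧ IsSupportedIn D G K) ∧ (pairingMatrix D x₀ A B G).det ≠ 0) := by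
  rintro ⟨X, _, _, _, _, _, _, D, hD, 𝒟, x₀, hx₀⟩ hM
  obtain ⟨A₀, hanti, hdet⟩ := exists_antisymm_areDetectorsAt X D 𝒟 x₀ hx₀
  obtain ⟨G, -, -, -, -, hG⟩ :=
    hM X D hD 𝒟 x₀ 1 (fun _ ↦ A₀) (fun _ ↦ 0) hdet Set.univ isOpen_univ (Set.mem_univ _)
  exact hG (det_pairingMatrix_eq_zero_of_antisymm X D x₀ A₀ hanti G)

end Summit.FinalStateConjecture.FinalStateConjecture.Theorems.SymplecticDualOfTheBomb

end
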